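import Literature.AlgebraicGeometry.Motives.ProjTwistSections
import Literature.AlgebraicGeometry.Motives.CoherentFracFamily
import Literature.AlgebraicGeometry.Motives.AffineCechAcyclic
import Literature.AlgebraicGeometry.Motives.ProjBaseChangeAny
import Literature.Algebra.Homology.OrderedCechTransfer
import Mathlib.AlgebraicGeometry.Noetherian
import HarnessLib

/-!
# The Chow family `π_*𝒪_{Z}(dH)` of a projective birational cover is a coherent family

Let `V` be an integral scheme, separated and locally Noetherian over `Spec A`, and `π : Z → V` a
dominant morphism from an integral closed subscheme `ι : Z ↪ 𝐏ⁿ_A` (over `A`) inducing a bijection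
`π^* : K(V) ⥲ K(Z)` (a Chow cover, `Literature/AlgebraicGeometry/Resolution/ChowLemmaRing`), with
twisted coordinates `ℓ_j` as in `Motives/ProjTwistDictionary`. For a finite cover `𝔘` of `V` with
affine intersections (`FracFamily.CoverData`, `Motives/CoherentFracFamily`) and `d ∈ ℤ`, the
**Chow family**

  `𝓖_d t = (π^*)⁻¹ Γ(π⁻¹U_t, 𝒪_Z(dH)) ⊆ K(V)`   (`ChowFamily.fam`)

(the sections of the pointwise family `ProjTwist.Pd d` of `Motives/ProjTwistSections` over `π⁻¹U_t`,
read in `K(V)`; i.e. `Γ(U_t, π_*𝒪_Z(dH))`) is a COHERENT rank-one family on `𝔘`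
(`ChowFamily.isCoherent_fam`; Görtz–Wedhorn II, Thm. 23.17 proof, assertion (3): `𝓖 = π_*𝓛^{⊗n}`
is coherent): it is a `Γ(U_t, 𝒪_V)`-module; FINITELY GENERATED because
`Γ(π⁻¹U_t, 𝒪_Z(dH)) = ⋂_j evFam Γ(U_t, 𝒪_V) θ d {j} = Ȟ⁰` of the evaluated Čech complex over the
Noetherian ring `Γ(U_t, 𝒪_V)` (`ProjTwist.secs_Pd_preimage_inf_eq`, Serre's theorem in degree `0`,
`LaurentCech.moduleFinite_homology_evCplx`, `OrderedCech.moduleFinite_iInf_of_homology_zero`); its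
STALKS do not depend on the chart because `π_*` of the quasi-coherent `𝒪_Z(dH)` is quasi-coherent,
proved here through poles of bounded order along `V(g)` on the affine pieces
`π⁻¹U_s ∩ Z_{ℓ_j}` (`AffineCech.exists_forall_le_isRegularAt_pow_mul`,
`SeparatedAffinePreimage.isAffineOpen_inf_preimage`). Moreover `1 ∈ 𝓖_d t` for `d ≥ 0`.

Everything is proved; no named facts.

## References

* U. Görtz, T. Wedhorn, *Algebraic Geometry II* (2023): Thm. 23.17 and its proof, Cor. 23.18
  (pp. 424–425); Thm. 23.1 (p. 412). [GortzWedhorn2023]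
* U. Görtz, T. Wedhorn, *Algebraic Geometry I*, 2nd ed. (2020): (7.9), Thm. 13.100. [GortzWedhorn2020]
-/

noncomputable section

open CategoryTheory AlgebraicGeometry TopologicalSpace Opposite HomogeneousLocalization
open Literature.Algebra.Homology Literature.Algebra.Homology.LaurentCech
open Literature.Algebra.Homology.OrderedCech
open Literature.AlgebraicGeometry.Morphisms Literature.AlgebraicGeometry.Morphisms.ProjCech
open Literature.AlgebraicGeometry.Motives.RatFn Literature.AlgebraicGeometry.Motives.ProjFrac
open Literature.AlgebraicGeometry.Motives.FracFamily Literature.AlgebraicGeometry.Motives.ProjTwist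

universe u

attribute [local instance] MvPolynomial.gradedAlgebra
  Literature.AlgebraicGeometry.Motives.ProjBaseChange.algebraBase

namespace Literature.AlgebraicGeometry.Motives

namespace ChowFamily

variable {A : Type u} [CommRing A] {n : ℕ}
  {Z : Scheme.{u}} [IsIntegral Z] (ι : Z ⟶ PP A n)
  (c : Fin (n + 1) → A) (a₀ : Fin (n + 1)) (hc : c a₀ = 0)
  (ha₀ : genericPoint Z ∈ ZH ι (MvPolynomial.X a₀)) (hℓ : ∀ j, genericPoint Z ∈ ZH ι (ell c a₀ j))
  {V : Scheme.{u}} [IsIntegral V] (q : V ⟶ Spec (.of A)) (π : Z ⟶ V) [IsDominant π]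
  (hι : ι ≫ toSpec A n = π ≫ q)
  [Algebra A V.functionField] [Algebra A Z.functionField]
  (hAV : ∀ a : A, algebraMap A V.functionField a =
    ofSection (U := ⊤) (Set.mem_univ _) (q.appTop ((Scheme.ΓSpecIso (.of A)).inv a)))
  (hAZ : ∀ a : A, algebraMap A Z.functionField a = functionFieldMap π (algebraMap A V.functionField a))
  (hbij : Function.Bijective (functionFieldMap π))

/-! ### The scalars -/

include hAV hAZ hι in
/-- The `A`-algebra structure of `K(Z)` is the one through `ι` and `𝐏ⁿ_A → Spec A`. [folklore] -/
theorem algebraMap_Z_eq (a : A) : algebraMap A Z.functionField a =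
    ofSection (U := ⊤) (Set.mem_univ _) ((ι ≫ toSpec A n).appTop ((Scheme.ΓSpecIso (.of A)).inv a)) := by
  rw [hAZ, hAV, functionFieldMap_ofSection, hι, Scheme.Hom.comp_appTop,
    CategoryTheory.ConcreteCategory.comp_apply]
  rfl

include hAV hAZ hι in
/-- Scalars are regular everywhere on `Z`. [folklore] -/
theorem isRegularAt_algebraMap_Z (a : A) (y : Z) : IsRegularAt y (algebraMap A Z.functionField a) :=
  isRegularAt_algebraMap_of_hA ι (algebraMap_Z_eq ι q π hι hAV hAZ) a y

include hAV in
/-- Scalars are regular everywhere on `V`. [folklore] -/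
theorem isRegularAt_algebraMap_V (a : A) (y : V) : IsRegularAt y (algebraMap A V.functionField a) := by
  rw [hAV]
  exact isRegularAt_ofSection (Set.mem_univ y) _

/-- **`π^* : K(V) ⥲ K(Z)` as an `A`-linear isomorphism** (bijective for a birational `π`,
`RatFn.functionFieldMap_bijective_of_isIso_morphismRestrict`). [folklore] -/
def eK : V.functionField ≃ₗ[A] Z.functionField :=
  (AlgEquiv.ofBijective ({ functionFieldMap π with commutes' := fun a => (hAZ a).symm } :
    V.functionField →ₐ[A] Z.functionField) hbij).toLinearEquiv

/-- `eK` is `π^*`. [folklore] -/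
@[simp] theorem eK_apply (x : V.functionField) : eK π hAZ hbij x = functionFieldMap π x := rfl

/-- `eK` is multiplicative. [folklore] -/
theorem eK_mul (x y : V.functionField) : eK π hAZ hbij (x * y) = eK π hAZ hbij x * eK π hAZ hbij y := by
  simp only [eK_apply, map_mul]

/-- `eK⁻¹` is multiplicative. [folklore] -/
theorem eK_symm_mul (x y : Z.functionField) :
    (eK π hAZ hbij).symm (x * y) = (eK π hAZ hbij).symm x * (eK π hAZ hbij).symm y := by
  apply (eK π hAZ hbij).injective
  rw [eK_mul, LinearEquiv.apply_symm_apply, LinearEquiv.apply_symm_apply, LinearEquiv.apply_symm_apply]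

/-- `eK 1 = 1`. [folklore] -/
theorem eK_one : eK π hAZ hbij 1 = 1 := by rw [eK_apply, map_one]

/-- `π^*` of a function `b ∈ Γ(U, 𝒪_V)` is the rational function of `π^*(b) ∈ Γ(π⁻¹U, 𝒪_Z)`.
[folklore] -/
theorem eK_algebraMap_sections (U : V.Opens) [Nonempty U] (hU : genericPoint V ∈ U) (b : Γ(V, U)) :
    eK π hAZ hbij (algebraMap Γ(V, U) V.functionField b) =
      ofSection (genericPoint_mem_preimage π hU) (π.app U b) := by
  rw [eK_apply]
  change functionFieldMap π (ofSection hU b) = _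
  rw [functionFieldMap_ofSection]

/-! ### The charts `Z_{ℓ_j}` cover `Z` -/

omit [IsIntegral Z] [Algebra A Z.functionField] in
include hc in
/-- Every point of `Z` lies in some `Z_{ℓ_j}` (the `D₊(ℓ_j)` cover `𝐏ⁿ_A`: the `ℓ_j` generate the
irrelevant ideal). [folklore] -/
theorem exists_mem_ZH_ell (y : Z) : ∃ j, y ∈ ZH ι (ell c a₀ j) := by
  have hcov : ⨆ j, Proj.basicOpen (grading A n) (ell c a₀ j) = ⊤ := by
    refine Proj.iSup_basicOpen_eq_top (𝒜 := grading A n) (fun j => ell c a₀ j)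
      ((ProjBaseChangeRing.irrelevant_le_span_X A).trans ?_)
    rw [Ideal.span_le]
    rintro _ ⟨j, rfl⟩
    have hX : (MvPolynomial.X j : MvPolynomial (Fin (n + 1)) A) =
        ell c a₀ j - MvPolynomial.C (c j) * ell c a₀ a₀ := by
      rw [ell_self c a₀ hc, ell]; ring
    rw [SetLike.mem_coe, hX]
    exact Ideal.sub_mem _ (Ideal.subset_span ⟨j, rfl⟩)
      (Ideal.mul_mem_left _ _ (Ideal.subset_span ⟨a₀, rfl⟩))
  have hy : ι y ∈ (⨆ j, Proj.basicOpen (grading A n) (ell c a₀ j)) := by rw [hcov]; trivial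
  obtain ⟨j, hj⟩ := Opens.mem_iSup.1 hy
  exact ⟨j, hj⟩

/-! ### The Chow family -/

section Fam

variable {κ : Type} (𝔘 : CoverData V κ)

/-- **The Chow family `𝓖_d t = (π^*)⁻¹ Γ(π⁻¹U_t, 𝒪_Z(dH)) ⊆ K(V)`**, i.e. `Γ(U_t, π_*𝒪_Z(dH))`
(Görtz–Wedhorn II, proof of Thm. 23.17, assertion (3): `𝓖 = π_*𝓛^{⊗n}`).
[cite: GortzWedhorn2023, Thm. 23.17 proof (p. 425)] -/
def fam (d : ℤ) (t : Finset κ) : Submodule A V.functionField :=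
  (PtFamily.secs (Pd ι c a₀ ha₀ (isRegularAt_algebraMap_Z ι q π hι hAV hAZ) d) (π ⁻¹ᵁ 𝔘.U t)).comap
    (eK π hAZ hbij).toLinearMap

/-- Membership in the Chow family. [folklore] -/
theorem mem_fam_iff {d : ℤ} {t : Finset κ} {x : V.functionField} :
    x ∈ fam ι c a₀ ha₀ q π hι hAV hAZ hbij 𝔘 d t ↔
      ∀ y ∈ π ⁻¹ᵁ 𝔘.U t, eK π hAZ hbij x ∈ Pd ι c a₀ ha₀ (isRegularAt_algebraMap_Z ι q π hι hAV hAZ) d y := by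
  rw [fam, Submodule.mem_comap, LinearEquiv.coe_coe, PtFamily.mem_secs]

/-- The Chow family is monotone. [folklore] -/
theorem fam_mono (d : ℤ) : Monotone (fam ι c a₀ ha₀ q π hι hAV hAZ hbij 𝔘 d) := fun _ _ hst _ hx =>
  (mem_fam_iff _ _ _ _ _ _ _ _ _ _ _).2 fun y hy => (mem_fam_iff _ _ _ _ _ _ _ _ _ _ _).1 hx y (𝔘.anti hst hy)

/-- **`1 ∈ 𝓖_d t` for `d ≥ 0`.** [folklore] -/
theorem one_mem_fam {d : ℤ} (hd : 0 ≤ d) (t : Finset κ) :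
    (1 : V.functionField) ∈ fam ι c a₀ ha₀ q π hι hAV hAZ hbij 𝔘 d t := by
  rw [mem_fam_iff, eK_one]
  exact fun y _ => one_mem_Pd ι c a₀ ha₀ _ hd y

/-- Elements of the Chow family are multiplied into it by functions regular on `U_t`. [folklore] -/
theorem algebraMap_mul_mem_fam {d : ℤ} {t : Finset κ} (b : Γ(V, 𝔘.U t)) {x : V.functionField}
    (hx : x ∈ fam ι c a₀ ha₀ q π hι hAV hAZ hbij 𝔘 d t) :
    algebraMap Γ(V, 𝔘.U t) V.functionField b * x ∈ fam ι c a₀ ha₀ q π hι hAV hAZ hbij 𝔘 d t := by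
  rw [mem_fam_iff] at hx ⊢
  intro y hy
  rw [eK_mul, eK_algebraMap_sections π hAZ hbij (𝔘.U t) (𝔘.genericPoint_mem t)]
  exact isRegularAt_mul_mem_Pd ι c a₀ ha₀ _ (isRegularAt_ofSection hy _) (hx y hy)

/-- `eK` commutes with powers. [folklore] -/
theorem eK_pow (x : V.functionField) (N : ℕ) : eK π hAZ hbij (x ^ N) = eK π hAZ hbij x ^ N := by
  simp only [eK_apply, map_pow]

end Fam

/-! ### Coherence of the Chow family -/

section Coherent

variable [IsClosedImmersion ι] [IsSeparated q] [IsLocallyNoetherian V] {κ : Type} (𝔘 : CoverData V κ)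

omit [IsClosedImmersion ι] [IsSeparated q] [IsLocallyNoetherian V] in
include hc in
/-- Sections over `π⁻¹U` are the rational functions which are sections over every `π⁻¹U ∩ Z_{ℓ_j}`.
[folklore] -/
theorem mem_secs_preimage_iff (U : V.Opens) (d : ℤ) (x : Z.functionField) :
    x ∈ PtFamily.secs (Pd ι c a₀ ha₀ (isRegularAt_algebraMap_Z ι q π hι hAV hAZ) d) (π ⁻¹ᵁ U) ↔
      ∀ j, x ∈ PtFamily.secs (Pd ι c a₀ ha₀ (isRegularAt_algebraMap_Z ι q π hι hAV hAZ) d)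
        (π ⁻¹ᵁ U ⊓ ZH ι (α c a₀ (Xs A {j}))) := by
  simp only [PtFamily.mem_secs]
  refine ⟨fun h j y hy => h y hy.1, fun h y hy => ?_⟩
  obtain ⟨j, hj⟩ := exists_mem_ZH_ell ι c a₀ hc y
  exact h j y ⟨hy, by rwa [Xs_singleton, α_X]⟩

include hc hℓ in
/-- **The Chow family is finitely generated over the rings of the charts** (Serre's theorem in
degree `0` over the Noetherian ring `Γ(U_t, 𝒪_V)`: `Γ(π⁻¹U_t, 𝒪_Z(dH)) = ⋂_j evFam Γ(U_t) θ d {j}`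
is `Ȟ⁰` of the evaluated Čech complex). [cite: GortzWedhorn2023, Thm. 23.1 (1) (p. 412) and Thm. 23.17 proof (p. 425)] -/
theorem fam_fg {d : ℤ} {t : Finset κ} (ht : t.Nonempty) :
    ∃ S : Finset V.functionField,
      (S : Set V.functionField) ⊆ fam ι c a₀ ha₀ q π hι hAV hAZ hbij 𝔘 d t ∧
        fam ι c a₀ ha₀ q π hι hAV hAZ hbij 𝔘 d t ≤ chartSpan (𝔘.U t) (S : Set V.functionField) := by
  classical
  have hU := 𝔘.genericPoint_mem t
  have hUaff := 𝔘.affine ht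
  letI algVU : Algebra Γ(V, 𝔘.U t) Z.functionField := secAlgebraZ π (𝔘.U t)
  haveI : IsNoetherianRing Γ(V, 𝔘.U t) :=
    IsLocallyNoetherian.component_noetherian (⟨𝔘.U t, hUaff⟩ : V.affineOpens)
  have hθ := isUnit_theta ι c a₀ ha₀ hℓ
  set Ffam := evFam Γ(V, 𝔘.U t) (theta ι c a₀ ha₀) hθ (fun _ : Unit => (1 : Z.functionField))
    (0 : Unit → ℤ) d with hFdef
  haveI hfinH : Module.Finite Γ(V, 𝔘.U t) ((complex Ffam (evFam_mono _ _ hθ _ _ d)).homology 0) :=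
    moduleFinite_homology_evCplx Γ(V, 𝔘.U t) (theta ι c a₀ ha₀) hθ _ _ d 0
  haveI : Inhabited (Fin (n + 1)) := ⟨0⟩
  haveI hfinM : Module.Finite Γ(V, 𝔘.U t) (⨅ j, Ffam {j} : Submodule Γ(V, 𝔘.U t) Z.functionField) :=
    moduleFinite_iInf_of_homology_zero Ffam (evFam_mono _ _ hθ _ _ d) hfinH
  -- the carrier of `⋂_j Ffam {j}` is `Γ(π⁻¹U_t, 𝒪_Z(dH))`
  have hcarr : ∀ x : Z.functionField, x ∈ (⨅ j, Ffam {j} : Submodule Γ(V, 𝔘.U t) Z.functionField) ↔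
      x ∈ PtFamily.secs (Pd ι c a₀ ha₀ (isRegularAt_algebraMap_Z ι q π hι hAV hAZ) d) (π ⁻¹ᵁ 𝔘.U t) := by
    intro x
    rw [Submodule.mem_iInf, mem_secs_preimage_iff ι c a₀ hc ha₀ q π hι hAV hAZ]
    refine forall_congr' fun j => ?_
    have := secs_Pd_preimage_inf_eq ι c a₀ hc ha₀ hℓ (isRegularAt_algebraMap_Z ι q π hι hAV hAZ)
      (algebraMap_Z_eq ι q π hι hAV hAZ) q π hι hUaff hU (Finset.singleton_nonempty j) d
    exact (Set.ext_iff.1 this x).symm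
  -- generators over `Γ(U_t, 𝒪_V)`
  obtain ⟨S', hS'⟩ := Module.Finite.fg_top (R := Γ(V, 𝔘.U t))
    (M := (⨅ j, Ffam {j} : Submodule Γ(V, 𝔘.U t) Z.functionField))
  set e := eK π hAZ hbij with he
  refine ⟨S'.image fun m : (⨅ j, Ffam {j} : Submodule Γ(V, 𝔘.U t) Z.functionField) =>
    e.symm (m : Z.functionField), ?_, ?_⟩
  · intro x hx
    obtain ⟨m, -, rfl⟩ := Finset.mem_image.1 (Finset.mem_coe.1 hx)
    rw [SetLike.mem_coe, mem_fam_iff]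
    have := PtFamily.mem_secs.1 ((hcarr _).1 m.2)
    intro y hy
    rw [he, LinearEquiv.apply_symm_apply]
    exact this y hy
  · intro x hx
    have hxM : e x ∈ (⨅ j, Ffam {j} : Submodule Γ(V, 𝔘.U t) Z.functionField) :=
      (hcarr _).2 (PtFamily.mem_secs.2 ((mem_fam_iff ι c a₀ ha₀ q π hι hAV hAZ hbij 𝔘).1 hx))
    have hspan : (⟨e x, hxM⟩ : (⨅ j, Ffam {j} : Submodule Γ(V, 𝔘.U t) Z.functionField)) ∈
        Submodule.span Γ(V, 𝔘.U t) (S' : Set _) := by rw [hS']; trivial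
    have key : ∀ m : (⨅ j, Ffam {j} : Submodule Γ(V, 𝔘.U t) Z.functionField),
        m ∈ Submodule.span Γ(V, 𝔘.U t) (S' : Set _) →
          e.symm (m : Z.functionField) ∈ chartSpan (A := A) (𝔘.U t)
            ((S'.image fun m : (⨅ j, Ffam {j} : Submodule Γ(V, 𝔘.U t) Z.functionField) =>
              e.symm (m : Z.functionField) : Finset V.functionField) : Set V.functionField) := by
      intro m hm
      induction hm using Submodule.span_induction with
      | mem m hm =>
        exact subset_chartSpan _ _ (Finset.mem_coe.2 (Finset.mem_image_of_mem _ hm))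
      | zero => rw [Submodule.coe_zero, map_zero]; exact Submodule.zero_mem _
      | add m m' _ _ h1 h2 => rw [Submodule.coe_add, map_add]; exact Submodule.add_mem _ h1 h2
      | smul b m _ h1 =>
        rw [Submodule.coe_smul, Algebra.smul_def,
          show algebraMap Γ(V, 𝔘.U t) Z.functionField b =
            e (algebraMap Γ(V, 𝔘.U t) V.functionField b) from rfl,
          eK_symm_mul, he, LinearEquiv.symm_apply_apply]
        exact algebraMap_mul_mem_chartSpan (𝔘.U t) b h1
    have := key _ hspan
    have h2 : e.symm ((⟨e x, hxM⟩ : (⨅ j, Ffam {j} : Submodule Γ(V, 𝔘.U t) Z.functionField)) :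
        Z.functionField) = x := e.symm_apply_apply x
    rw [h2] at this
    exact this

omit [IsLocallyNoetherian V] in
include hc hℓ in
/-- **Bounded poles along `V(g)`**: for `g ∈ Γ(U_s, 𝒪_V)` with `V_g ⊆ U_t` and `x ∈ 𝓖_d t`, some
`g^N x` lies in `𝓖_d s` — the quasi-coherence of `π_*𝒪_Z(dH)` on the affine `U_s`
(`Γ(π⁻¹V_g) = Γ(π⁻¹U_s)_g`), proved on the affine pieces `π⁻¹U_s ∩ Z_{ℓ_j}`
(`AffineCech.exists_forall_le_isRegularAt_pow_mul`). [folklore] -/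
theorem exists_pow_mul_mem_fam {d : ℤ} {s t : Finset κ} (hs : s.Nonempty) (g : Γ(V, 𝔘.U s))
    (hgle : V.basicOpen g ≤ 𝔘.U t) {x : V.functionField}
    (hx : x ∈ fam ι c a₀ ha₀ q π hι hAV hAZ hbij 𝔘 d t) :
    ∃ N : ℕ, algebraMap Γ(V, 𝔘.U s) V.functionField g ^ N * x ∈ fam ι c a₀ ha₀ q π hι hAV hAZ hbij 𝔘 d s := by
  classical
  have hUs := 𝔘.genericPoint_mem s
  have hUsaff := 𝔘.affine hs
  set g' : Z.functionField := ofSection (genericPoint_mem_preimage π hUs) (π.app (𝔘.U s) g) with hg'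
  have heg : eK π hAZ hbij (algebraMap Γ(V, 𝔘.U s) V.functionField g) = g' :=
    eK_algebraMap_sections π hAZ hbij (𝔘.U s) hUs g
  have hx' := (mem_fam_iff ι c a₀ ha₀ q π hι hAV hAZ hbij 𝔘).1 hx
  -- bounded poles on each affine piece `Z_{ℓ_j} ∩ π⁻¹U_s`
  have hW : ∀ j, ∃ M : ℕ, ∀ M', M ≤ M' → ∀ y ∈ ZH ι (ell c a₀ j) ⊓ π ⁻¹ᵁ 𝔘.U s,
      IsRegularAt y (g' ^ M' * ((theta ι c a₀ ha₀ j ^ d)⁻¹ * eK π hAZ hbij x)) := fun j => by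
    have haff : IsAffineOpen (ZH ι (ell c a₀ j) ⊓ π ⁻¹ᵁ 𝔘.U s) :=
      SeparatedAffinePreimage.isAffineOpen_inf_preimage π q (isAffineOpen_ZH ι (ell_mem c a₀ j) one_pos)
        hUsaff
    have hξ : genericPoint Z ∈ ZH ι (ell c a₀ j) ⊓ π ⁻¹ᵁ 𝔘.U s := ⟨hℓ j, genericPoint_mem_preimage π hUs⟩
    have hβ : ∀ y ∈ ZH ι (ell c a₀ j) ⊓ π ⁻¹ᵁ 𝔘.U s, y ∈ Z.basicOpen (π.app (𝔘.U s) g) →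
        IsRegularAt y ((theta ι c a₀ ha₀ j ^ d)⁻¹ * eK π hAZ hbij x) := fun y hy hyg => by
      have hyt : y ∈ π ⁻¹ᵁ 𝔘.U t := by
        rw [← Scheme.preimage_basicOpen] at hyg
        exact hgle hyg
      exact (mem_Pd_iff_of_mem ι c a₀ ha₀ hℓ _ hy.1).1 (hx' y hyt)
    obtain ⟨M, hM⟩ := AffineCech.exists_forall_le_isRegularAt_pow_mul (Y := Z) (U := π ⁻¹ᵁ 𝔘.U s)
      inf_le_right haff hξ (π.app (𝔘.U s) g) hβ
    exact ⟨M, hM⟩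
  choose M hM using hW
  refine ⟨Finset.univ.sup M, (mem_fam_iff ι c a₀ ha₀ q π hι hAV hAZ hbij 𝔘).2 fun y hy => ?_⟩
  obtain ⟨j, hj⟩ := exists_mem_ZH_ell ι c a₀ hc y
  refine (mem_Pd_iff_of_mem ι c a₀ ha₀ hℓ _ hj).2 ?_
  rw [eK_mul, eK_pow, heg, mul_left_comm]
  exact hM j _ (Finset.le_sup (Finset.mem_univ j)) y ⟨hj, hy⟩

omit [IsLocallyNoetherian V] in
include hc hℓ in
/-- **The stalks of the Chow family do not depend on the chart** (quasi-coherence of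
`π_*𝒪_Z(dH)`: `𝓖_d t ⊆ 𝒪_{V,y} · 𝓖_d s` for `y ∈ U_t ⊆ U_s`, through a basic open
`y ∈ V_g ⊆ U_t` of the affine `U_s` and `exists_pow_mul_mem_fam`). [folklore] -/
theorem fam_stalk_le {d : ℤ} {s t : Finset κ} (hs : s.Nonempty) (hst : s ⊆ t) {y : V} (hy : y ∈ 𝔘.U t) :
    stalkSpan (A := A) y (fam ι c a₀ ha₀ q π hι hAV hAZ hbij 𝔘 d t : Set V.functionField) ≤
      stalkSpan y (fam ι c a₀ ha₀ q π hι hAV hAZ hbij 𝔘 d s : Set V.functionField) := by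
  classical
  refine stalkSpan_le ?_ fun f z hf hz => isRegularAt_mul_mem_stalkSpan hf hz
  intro x hx
  have hys : y ∈ 𝔘.U s := 𝔘.anti hst hy
  obtain ⟨g, hgle, hyg⟩ := (𝔘.affine hs).exists_basicOpen_le ⟨y, hy⟩ hys
  set gf : V.functionField := algebraMap Γ(V, 𝔘.U s) V.functionField g with hgf
  have hunit : IsUnitAt y gf := by
    rw [hgf, show algebraMap Γ(V, 𝔘.U s) V.functionField g = ofSection (𝔘.genericPoint_mem s) g from rfl,
      ofSection_eq_toFunctionField hys, isUnitAt_germ_iff]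
    exact hyg
  obtain ⟨N, hN⟩ := exists_pow_mul_mem_fam ι c a₀ hc ha₀ hℓ q π hι hAV hAZ hbij 𝔘 hs g hgle hx
  have e : x = (gf ^ N)⁻¹ * (gf ^ N * x) := by
    rw [← mul_assoc, inv_mul_cancel₀ (pow_ne_zero N hunit.ne_zero), one_mul]
  rw [e]
  exact Submodule.subset_span ⟨(gf ^ N)⁻¹, gf ^ N * x, (hunit.pow N).inv.isRegularAt, hN, rfl⟩

include hc hℓ in
/-- **The Chow family `𝓖_d` is a coherent family on `𝔘`** (Görtz–Wedhorn II, proof of Thm. 23.17,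
assertion (3): `π_*𝓛^{⊗n}` is coherent; here: `Γ(U_t, 𝒪_V)`-module, finitely generated by Serre's
theorem in degree `0` over `Γ(U_t, 𝒪_V)`, stalks independent of the chart by quasi-coherence).
[cite: GortzWedhorn2023, Thm. 23.17 proof, assertion (3) (p. 425)] -/
theorem isCoherent_fam (d : ℤ) : IsCoherent 𝔘 (fam ι c a₀ ha₀ q π hι hAV hAZ hbij 𝔘 d) where
  mono := fam_mono ι c a₀ ha₀ q π hι hAV hAZ hbij 𝔘 d
  smul_mem _ _ b _ hx := algebraMap_mul_mem_fam ι c a₀ ha₀ q π hι hAV hAZ hbij 𝔘 b hx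
  fg _ ht := fam_fg ι c a₀ hc ha₀ hℓ q π hι hAV hAZ hbij 𝔘 ht
  stalk_le _ _ hs hst _ hy := fam_stalk_le ι c a₀ hc ha₀ hℓ q π hι hAV hAZ hbij 𝔘 hs hst hy

end Coherent

end ChowFamily

end Literature.AlgebraicGeometry.Motives

end
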